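import Literature.Analysis.FluidPDE.KwonLocalLerayDuality
import HarnessLib

/-!
# Kwon's harmonic part as a kernel integral against the velocity

Analysis/FluidPDE proof file (theorems only) on the discharge path of the named fact
`Literature.Analysis.FluidPDE.kwon2023_velocity_epsilon_regularity`
(`PressureFreeEpsilonRegularity.lean`; H. Kwon, J. Differential Equations (2023) =
arXiv:2104.03160, Thm. 1.4). Kwon's drift `h = H u` (Remark 2.3 (2.3):
`h = −curl(∇Φ × Δ⁻¹((1 − φ)ω))`; the tree's `harmonicPart u = ∇(k ⋆ (u·∇φ)) − curl(k ⋆ (∇φ × u))`)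
is an INTEGRAL OPERATOR on the velocity with a smooth kernel supported in the shell
`5/4 ≤ |y| ≤ 7/4`:

* `Kwon2023.gradient_potential_scalar_eq_integral` — `∇(k ⋆ (u·∇φ))(x) = ∫ (u·∇φ)(y) ∇k(x − y) dy`;
* `Kwon2023.harmonicPart_eq_integral` —
  `h(x) = ∫ [(u(y)·∇φ(y)) ∇k(x − y) − ∇k(x − y) × (∇φ(y) × u(y))] dy`;
* `Kwon2023.harmonicPart_eq_setIntegral_ball` — the same over `B₂` (the integrand vanishes off
  the shell, `Kwon2023.harmonicPartIntegrand_eq_zero_of_not_shell`).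

This is the starting point of the time-regularity step of Lemma 2.5 ("(T1)" of the design memo
`kits/A4-R1b-localEnergy-design-ser-a-g8.md`: `∂ₜh(t,x)` is obtained by testing the Navier–Stokes
equations with the `y`-kernel). No NS-regularity statement is touched.

## Mathlib / tree search

Tree (reused): `harmonicPart`, `annularKernel`, `scalarDensity`, `vectorDensity`,
`integrable_scalarDensity`, `integrable_vectorDensity`, `fderiv_potential_scalar_eq`,
`scalarDensity_eq_zero_of_lt/gt`, `vectorDensity_eq_zero_of_lt/gt`,
`exists_bound_gradient_annularKernel` (`KwonHarmonicPart`, `KwonLocalLerayDuality`);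
`curl_convolution_lsmul_eq_integral_cross_of_locallyIntegrable` (`KwonLocalLerayDuality`).
Mathlib: `InnerProductSpace.toDual_symm_apply`, `ext_inner_right`, `integral_inner`,
`convolution_lsmul_swap`, `integral_sub`, `setIntegral_eq_integral_of_forall_compl_eq_zero`.

## References

* H. Kwon, *The role of the pressure in the regularity theory for the Navier–Stokes equations*,
  J. Differential Equations 357 (2023) = arXiv:2104.03160: Remark 2.3 (2.3) and Lemma 2.5.
  [Kwon2023RolePressure]
-/

noncomputable section

open MeasureTheory Set Function Filter Topology TopologicalSpace Metric InnerProductSpace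
  ContinuousLinearMap
open scoped NNReal ENNReal RealInnerProductSpace Convolution ContDiff

namespace Literature.Analysis.FluidPDE

namespace Kwon2023

variable {u : EuclideanSpace ℝ (Fin 3) → EuclideanSpace ℝ (Fin 3)}

/-- The scalar-density piece of the kernel integrand is integrable. [folklore] -/
private theorem integrable_scalarDensity_smul_gradient (hu : IntegrableOn u (ball (0 : EuclideanSpace ℝ (Fin 3)) 2))
    (x : EuclideanSpace ℝ (Fin 3)) :
    Integrable fun y => scalarDensity u y • gradient annularKernel (x - y) := by
  obtain ⟨K, -, hK⟩ := exists_bound_gradient_annularKernel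
  have hs := integrable_scalarDensity hu
  have hgk : Continuous (gradient annularKernel) :=
    FluidPDE.continuous_gradient_of_contDiff (contDiff_annularKernel (n := 1))
  refine (hs.norm.mul_const K).mono'
    (hs.aestronglyMeasurable.smul (hgk.comp (continuous_const.sub continuous_id)).aestronglyMeasurable)
    (Eventually.of_forall fun y => ?_)
  rw [norm_smul]
  exact mul_le_mul_of_nonneg_left (hK _) (norm_nonneg _)

/-- The vector-density piece of the kernel integrand is integrable. [folklore] -/
private theorem integrable_cross_gradient_vectorDensity (hu : IntegrableOn u (ball (0 : EuclideanSpace ℝ (Fin 3)) 2))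
    (x : EuclideanSpace ℝ (Fin 3)) :
    Integrable fun y => cross (gradient annularKernel (x - y)) (vectorDensity u y) := by
  obtain ⟨K, hK0, hK⟩ := exists_bound_gradient_annularKernel
  have hv := integrable_vectorDensity hu
  have hgk : Continuous (gradient annularKernel) :=
    FluidPDE.continuous_gradient_of_contDiff (contDiff_annularKernel (n := 1))
  have hm : AEStronglyMeasurable (fun y => cross (gradient annularKernel (x - y)) (vectorDensity u y)) volume :=
    continuous_uncurry_cross.comp_aestronglyMeasurable₂
      (hgk.comp (continuous_const.sub continuous_id)).aestronglyMeasurable hv.aestronglyMeasurable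
  refine ((hv.norm.const_mul (‖crossCLM‖ * K))).mono' hm (Eventually.of_forall fun y => ?_)
  rw [← crossCLM_apply]
  calc ‖crossCLM (gradient annularKernel (x - y)) (vectorDensity u y)‖
      ≤ ‖crossCLM‖ * ‖gradient annularKernel (x - y)‖ * ‖vectorDensity u y‖ := le_opNorm₂ _ _ _
    _ ≤ ‖crossCLM‖ * K * ‖vectorDensity u y‖ := by
        gcongr
        exact hK _

/-- **The gradient of the scalar potential as a kernel integral**:
`∇(k ⋆ (u·∇φ))(x) = ∫ (u·∇φ)(y) ∇k(x − y) dy`. [cite: Kwon2023RolePressure, Remark 2.3 (2.3)] -/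
theorem gradient_potential_scalar_eq_integral (hu : IntegrableOn u (ball (0 : EuclideanSpace ℝ (Fin 3)) 2))
    (x : EuclideanSpace ℝ (Fin 3)) :
    gradient (annularKernel ⋆ scalarDensity u) x = ∫ y, scalarDensity u y • gradient annularKernel (x - y) := by
  have hs := integrable_scalarDensity hu
  have hI := integrable_scalarDensity_smul_gradient hu x
  refine ext_inner_right ℝ fun a => ?_
  rw [gradient, InnerProductSpace.toDual_symm_apply,
    show fderiv ℝ (annularKernel ⋆ scalarDensity u) x a =
      ((fun z => fderiv ℝ annularKernel z a) ⋆ scalarDensity u) x from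
      congrFun (fderiv_potential_scalar_eq hs.locallyIntegrable a) x,
    convolution_lsmul_swap, real_inner_comm, ← integral_inner hI a]
  refine integral_congr_ae (Eventually.of_forall fun y => ?_)
  dsimp only
  rw [smul_eq_mul, inner_smul_right, real_inner_comm, gradient, InnerProductSpace.toDual_symm_apply, mul_comm]

/-- **Kwon's harmonic part as a kernel integral against the velocity**:
`h(x) = ∫ [(u(y)·∇φ(y)) ∇k(x − y) − ∇k(x − y) × (∇φ(y) × u(y))] dy` for `u ∈ L¹(B₂)` — the
operator `h = −curl Δ⁻¹((1 − φ)ω)` of Remark 2.3 written out with the tree's annular kernel `k`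
and cut-off `φ`. [cite: Kwon2023RolePressure, Remark 2.3 (2.3)] -/
theorem harmonicPart_eq_integral (hu : IntegrableOn u (ball (0 : EuclideanSpace ℝ (Fin 3)) 2))
    (x : EuclideanSpace ℝ (Fin 3)) :
    harmonicPart u x = ∫ y, (scalarDensity u y • gradient annularKernel (x - y) -
      cross (gradient annularKernel (x - y)) (vectorDensity u y)) := by
  have hv := integrable_vectorDensity hu
  rw [integral_sub (integrable_scalarDensity_smul_gradient hu x) (integrable_cross_gradient_vectorDensity hu x),
    ← gradient_potential_scalar_eq_integral hu x,
    ← curl_convolution_lsmul_eq_integral_cross_of_locallyIntegrable (contDiff_annularKernel (n := 1))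
      hasCompactSupport_annularKernel hv.locallyIntegrable x]
  rfl

/-- The kernel integrand vanishes off the shell `5/4 ≤ |y| ≤ 7/4`, where `∇φ = 0` (Remark 2.3:
`φ = 1` on `B_{5/4}`, `supp φ ⊂ B_{7/4}`, so the densities `u·∇φ`, `∇φ × u` live in the shell).
[cite: Kwon2023RolePressure, Remark 2.3 (2.3)] -/
theorem harmonicPartIntegrand_eq_zero_of_not_shell {x y : EuclideanSpace ℝ (Fin 3)}
    (hy : ‖y‖ < 5 / 4 ∨ 7 / 4 < ‖y‖) :
    scalarDensity u y • gradient annularKernel (x - y) -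
      cross (gradient annularKernel (x - y)) (vectorDensity u y) = 0 := by
  rcases hy with hy | hy
  · rw [scalarDensity_eq_zero_of_lt hy, vectorDensity_eq_zero_of_lt hy, zero_smul, ← crossCLM_apply, map_zero,
      sub_zero]
  · rw [scalarDensity_eq_zero_of_gt hy, vectorDensity_eq_zero_of_gt hy, zero_smul, ← crossCLM_apply, map_zero,
      sub_zero]

/-- **The harmonic part as an integral over `B₂`** (the integrand is supported in the shell
`5/4 ≤ |y| ≤ 7/4 ⊂ B₂`). [cite: Kwon2023RolePressure, Remark 2.3 (2.3)] -/
theorem harmonicPart_eq_setIntegral_ball (hu : IntegrableOn u (ball (0 : EuclideanSpace ℝ (Fin 3)) 2))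
    (x : EuclideanSpace ℝ (Fin 3)) :
    harmonicPart u x = ∫ y in ball (0 : EuclideanSpace ℝ (Fin 3)) 2,
      (scalarDensity u y • gradient annularKernel (x - y) -
        cross (gradient annularKernel (x - y)) (vectorDensity u y)) := by
  rw [harmonicPart_eq_integral hu x]
  refine (setIntegral_eq_integral_of_forall_compl_eq_zero fun y hy => ?_).symm
  refine harmonicPartIntegrand_eq_zero_of_not_shell (Or.inr ?_)
  have hy' : ¬ ‖y‖ < 2 := by rwa [mem_ball_zero_iff] at hy
  linarith [not_lt.1 hy']

end Kwon2023

end Literature.Analysis.FluidPDE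

end
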